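import Literature.MathematicalPhysics.QuantumFieldTheory.Balaban1983to89.B8TowerBondsLayerLawSubC

/-!
# NODE 00 (YM-PLAN Track A) — THE (1.5)-OBEYING ADMISSIBLE SUB-INDEX OF RECORD `IdxB8SubD θ`: the members `j : IdxB8SubC θ` (`Ω₀ = ℤᵈ`, the four located laws, (1.3)–(1.4)
# `DomainSeq`) whose TOP constraint families READ PRINT'S (1.5) «`Λ_j = Ω_j^{(j)} ∖ Ω_{j+1}^{(j)}`» — the corner reading `∀ l < k, ∀ z ∈ Λs k l, Lˡ•z ∈ Lam L Ω l` (dag-n05-c g15's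
# DESIGN WORD «REPAIR LETTER = (1.5) `LamTop`, n05-w2's `hΛ` text»; a Subtype over `IdxB8SubC`, so `Subtype.val` composes with everything keyed on `SubC ∕ SubB`); faces; inhabitation

[Balaban1985RegularSpaces] = T. Bałaban, *Spaces of regular gauge field configurations on a lattice and gauge fixing conditions*, Commun. Math. Phys. **99** (1985) 75–102
— (1.3)–(1.6) p. 77 («Λ_j = Ω_j^{(j)} ∖ Ω_{j+1}^{(j)}, j = 0, 1, …, k − 1, Λ_k = Ω_k^{(k)}»), p. 77 «we admit the case where some domains Ω_j are equal to T_η», (1.131) p. 99.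

NODE 00 CARRIER MODULE (width seat `pub-ymgap-dag-n05-w1` g2, 2026-08-28; dag-n05-c g15 DESIGN WORD cell bus 2026-08-28 07:24Z: «a SUBTYPE `IdxB8SubD θ := {j : IdxB8SubC θ ∕∕ LamTop θ.L
j.1.1}` is warranted ONLY where a face must quantify over the (1.5)-members AS A TYPE — your Prop-5 carrier is such a place: define it ONCE in `Node00` … as a Subtype over `IdxB8SubC`; SAME
predicate text»).  APPEND-ONLY: a NEW importing module; NOTHING in `Node00/CarriersB8SubBP2C` (`IdxB8SubC`, this seat g0), `B8TowerBondsLayerLawSubC` ∕ `B8TowerBondsLayerLawOfLam` (dag-n05-w2 ∕ n05-w6: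
the (1.5) reading and its inhabitant at print's nested tower), `B8IdxB8LawsB` (n05-c), `B8ConstraintBonds` (`Lam`, `DomainSeq`) or below them is edited — everything CONSUMED BY NAME.

WHY.  The located laws №7 ∕ №8 ∕ №11 ∕ №12 and (1.3)–(1.4) do NOT carry (1.5): the all-`ℤᵈ` datum `Λs ≡ ⊤` is a term of `IdxB8SubC θ` at which [4]'s letters cannot exist (this seat's kernel certificate
`B8SockLettersRDIdxB8LawsBVacuity`, p613168; the READ-23 mechanism).  Where a face must range over (1.5)-members AS A TYPE — Proposition 5's carriers of record (`Node00/CarriersB8SubBPCutP5`),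
and any later re-index of the slot families — the index is this Subtype; where a ∀-binder suffices, the SAME text is conjoined as a member hypothesis (n05-c's (3)).

WHAT IS DEFINED ∕ PROVED (one definition + faces; 0 sorry): `IdxB8SubD θ` (def), `IdxB8SubD.toSubC` (`= Subtype.val`, `rfl`), the faces `IdxB8SubD.lamTop ∕ .domainSeq ∕ .lawsB ∕ .laws ∕ .Ω_zero ∕
.collar`, `IdxB8SubD.not_mem_succ_of_mem_Λs` ((1.5) read as «a top-family label of level `l < k` has its corner OUTSIDE `Ω_{l+1}`»), and ★ `nonempty_idxB8SubD` ∕ `exists_idxB8SubD_depth` (print's nested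
tower `(ℤᵈ, □₁, …, □_k)` at every depth `k ≥ 1` — dag-n05-w2 g3's `exists_idxB8SubC_topCube_pinned`, whose (1.5) IFF gives the law BY NAME).
HONEST FRAMING: one definition (a Subtype by print's (1.5) text) + bookkeeping; NO estimate; nothing of Bałaban asserted; whether the slot's t2 ∕ t4 ∕ p7 ∕ t8 families are re-indexed on it is NODE 00's ∕
the planners' ∕ dag-n05-d's call; count-neutral; N05 NOT discharged; one finite T⁴ programme at fixed ε, Bałaban AS PRINTED — NOT continuum ∕ ℝ⁴ ∕ OS ∕ mass gap ∕ Clay.  No `sorry`, no `instance`, no `notation`. -/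

noncomputable section

namespace Literature.MathematicalPhysics.QuantumFieldTheory.Balaban1983to89.Node00

open B7Prop1Explicit B7Prop1Local
open B8Ineq132 (Under)
open B8LeafModelZd (ZdIdx)
open B8ConstraintBonds (DomainSeq Lam)
open B8IdxB8LawsB (IdxB8LawsB IdxB8SubB)
open B8LeafModelZd3P (EndBlockIn)
open B8TowerBondsLayerLawSubC (exists_idxB8SubC_topCube_pinned)

variable (θ : Stage3Params)

/-- **THE (1.5)-OBEYING ADMISSIBLE SUB-INDEX OF RECORD** `IdxB8SubD θ`: the members of `IdxB8SubC θ` whose top constraint families read print's (1.5) at the corners — for every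
`l < k` and every label `z ∈ Λs k l`, the fine-lattice corner `Lˡ•z` lies in the layer `Lam L Ω l = {x | IsLevel L l x ∧ x ∈ Ω_l ∧ x ∉ Ω_{l+1}}` (the top level `l = k` needs nothing:
`ZdIdx.htower` puts `Bᵏ(Λs k k)` in `Ω_k`).  The text is n05-w2's `hΛ` of `B8TowerBondsLayerLawOfLam` ∕ `…SubC` VERBATIM (dag-n05-c's repair letter).
[cite: Balaban1985RegularSpaces, (1.5) p.77 («Λ_j = Ω_j^{(j)} ∖ Ω_{j+1}^{(j)}»), (1.3)–(1.4) p.77, p.77 («Ω_j = T_η»)] -/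
def IdxB8SubD : Type :=
  {j : IdxB8SubC θ // ∀ l, l < j.1.1.1.k → ∀ z ∈ j.1.1.1.Λs j.1.1.1.k l, ((θ.L : ℤ) ^ l) • z ∈ Lam θ.L j.1.1.1.Ω l}

variable {θ}

/-- The forgetful map to the admissible sub-index (`Subtype.val`). [cite: Balaban1985RegularSpaces, (1.3)–(1.5) p.77 (bookkeeping)] -/
def IdxB8SubD.toSubC (j : IdxB8SubD θ) : IdxB8SubC θ := j.1

/-- `toSubC` is the first projection (`rfl`). [cite: Balaban1985RegularSpaces, p.77 (bookkeeping)] -/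
theorem IdxB8SubD.toSubC_eq (j : IdxB8SubD θ) : j.toSubC = j.1 := rfl

/-- **The member's (1.5) reading** (the subtype's predicate): every top-family label of level `l < k` has its corner in the layer `Λ_l`.
[cite: Balaban1985RegularSpaces, (1.5) p.77] -/
theorem IdxB8SubD.lamTop (j : IdxB8SubD θ) :
    ∀ l, l < j.1.1.1.1.k → ∀ z ∈ j.1.1.1.1.Λs j.1.1.1.1.k l, ((θ.L : ℤ) ^ l) • z ∈ Lam θ.L j.1.1.1.1.Ω l :=
  j.2

/-- (1.5) read as an exclusion: the corner of a top-family label of level `l < k` is NOT in `Ω_{l+1}`. [cite: Balaban1985RegularSpaces, (1.5) p.77] -/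
theorem IdxB8SubD.smul_not_mem_succ (j : IdxB8SubD θ) {l : ℕ} (hl : l < j.1.1.1.1.k) {z : B7Prop1Explicit.Site θ.D} (hz : z ∈ j.1.1.1.1.Λs j.1.1.1.1.k l) :
    ((θ.L : ℤ) ^ l) • z ∉ j.1.1.1.1.Ω (l + 1) :=
  (j.2 l hl z hz).2.2

/-- The member's (1.3)–(1.4) domain law. [cite: Balaban1985RegularSpaces, (1.3)–(1.4) p.77] -/
theorem IdxB8SubD.domainSeq (j : IdxB8SubD θ) : DomainSeq θ.L j.1.1.1.1.Ω := j.1.2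

/-- The member's four located laws (n05-c's `IdxB8LawsB`). [cite: Balaban1985RegularSpaces, (1.5)–(1.6) p.77, p.86] -/
theorem IdxB8SubD.lawsB (j : IdxB8SubD θ) : IdxB8LawsB θ.L j.1.1.1.1 := j.1.1.2

/-- The member's three located laws of `Node00.IdxB8Laws` (forget №12). [cite: Balaban1985RegularSpaces, (1.6) p.77, (1.19) p.79, (1.34) p.82] -/
theorem IdxB8SubD.laws (j : IdxB8SubD θ) : IdxB8Laws θ.L j.1.1.1.1 := j.1.1.2.toIdxB8Laws

/-- The member's `Ω₀ = ℤᵈ`. [cite: Balaban1985RegularSpaces, p.77 («Ω_j = T_η»)] -/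
theorem IdxB8SubD.Ω_zero (j : IdxB8SubD θ) : j.1.1.1.1.Ω 0 = Set.univ := j.1.1.1.2

/-- The member's (1.4) axis collar (through `IdxB8SubC.collar`). [cite: Balaban1985RegularSpaces, (1.3)–(1.4) p.77] -/
theorem IdxB8SubD.collar (j : IdxB8SubD θ) :
    ∀ l, l ≤ j.1.1.1.1.k → ∀ (z : B7Prop1Explicit.Site θ.D) (μ : Fin θ.D), EndBlockIn θ.L (j.1.1.1.1.Ω l) l z μ →
      ∀ x, InBox (loK θ.L l z) (bondHiK θ.L l z μ) x → x ∈ j.1.1.1.1.Ω (l - 1) :=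
  j.1.collar

variable (θ)

/-- ★ **THE (1.5)-OBEYING SUB-INDEX IS INHABITED AT EVERY DEPTH `k ≥ 1`**: print's nested tower `(ℤᵈ, □₁, …, □_k)` with the pinned top family (dag-n05-w2 g3's
`exists_idxB8SubC_topCube_pinned`, whose (1.5) IFF `z ∈ Λs k l ↔ Lˡ•z ∈ Lam L Ω l` gives the law, forward direction). [cite: Balaban1985RegularSpaces, (1.131) p.99, (1.3)–(1.5) p.77] -/
theorem exists_idxB8SubD_depth {k : ℕ} (hk : 1 ≤ k) : ∃ j : IdxB8SubD θ, j.1.1.1.1.k = k := by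
  obtain ⟨j, hjk, -, -, -, hiff⟩ := exists_idxB8SubC_topCube_pinned θ hk
  exact ⟨⟨j, fun l hl z hz => (hiff l hl z).1 hz⟩, hjk⟩

/-- The (1.5)-obeying sub-index is non-empty. [cite: Balaban1985RegularSpaces, (1.131) p.99, (1.5) p.77 (bookkeeping)] -/
theorem nonempty_idxB8SubD : Nonempty (IdxB8SubD θ) :=
  let ⟨j, _⟩ := exists_idxB8SubD_depth θ le_rfl
  ⟨j⟩

end Literature.MathematicalPhysics.QuantumFieldTheory.Balaban1983to89.Node00

end
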